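import Summits.ResolutionOfSingularities.ResolutionOfSingularities.Theorems.FrobeniusLadderFInjectiveMacaulayficationRMonoidDefs
import Summits.ResolutionOfSingularities.ResolutionOfSingularities.Theorems.WildQuotientsWildQuotientResolutionToricChartWords

/-!
# T-TOR IN-HOUSE for the recurrent-monoid bed — DEFINITIONS of the (FREE′) certificate: the linear h.s.o.p. `θ`, the monomial basis `B`,
# its degrees, and the half-open unimodular cone decomposition (crux `FInjectiveMacaulayfication` stmt-ResolutionOfSingularities-15315, chain w45a;
# res-L1-w45a-plan-1 RULING R23.13 (2) + GO 06:28:28Z «(CM) = (FREE′)»; seat res-L1-w45a-lead-1 g13)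

[OURS · L1 W4.5a] Support file (`--supports stmt-ResolutionOfSingularities-15315 --as helper`); replaces the role of NO printed item; NOT a statement of any
manuscript; DEFINITIONS ONLY (data of a certificate; no theorem, no instance, no notation, no named fact). AI-written (AI review is weaker than expert review).

THE BED `k[R] = ToricChart.Ring k PEmpty RMonoidDefs.rDatum ≅ k[x₁, x₃, x₄, x₂x₃x₄, x₂x₄², x₁x₂x₄, x₁x₂x₃]`; its seven non-dummy symbols are indexed by
`Fin 7` in this order (`symElem`), and every monomial of `k[R]` is `wordElem (wordOf m)` for a multiplicity vector `m : Fin 7 → ℕ` (`wordOf` puts `0`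
on the dummy pure symbol). In the standard grading `u = (1,−1,1,1)` all seven symbols have degree `1`, so `deg (wordOf m) = Σ m`.
THE CERTIFICATE (lead-1 g13 `comp/hsop.py`, `dcd.py`, `table.py`; tri-2 g21 re-check l.85981):
* `thetaFun` — the LINEAR homogeneous system of parameters `θ = (x₁ + x₂x₃x₄, x₃ + x₂x₄², x₄ + x₁x₂x₃, x₁x₂x₄)`; `thetaPow a = ∏ θ_s^{a_s}`;
* `bMult`, `bElem`, `bDeg` — the monomial basis `B = (1, x₁x₂x₃, x₂x₃x₄, x₁x₂²x₃²x₄, x₂x₄²)` of `k[R]` over `k[θ]` (degrees `0,1,1,2,1`; `e(k[R]) = 5`);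
* `coneGen` — the five UNIMODULAR cones of a triangulation of `cone(R)` (as 4-sets of symbols), made half-open by a generic interior vector so that
  `ℕ⟨symbols⟩ = ⊔ᵢ (bMult i + ℕ⟨coneGen i⟩)` (only the disjointness / injectivity half is used: it bounds `dim_k` of the degree-`t` piece from below).
The 35 straightening identities `bElem i · symElem j = Σ ± thetaPow b · bElem i′` (spanning) and the injectivity of `(i,a) ↦ bMult i + Σ a_s e_{coneGen i s}`
(linear independence, degree by degree) are PROVED in the companion files `…RMonoidStraightening` / `…RMonoidFreeBasis`; with ✓`FlatIntegralCM` they give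
the Cohen–Macaulay clause at every prime of `k[R]`. [folklore data; cite: BrunsHerzog1998, Thm. 2.1.2 (context: Hironaka's criterion), Stanley1982 (context: half-open decompositions)]
-/

-- single-problem summit: the doubled namespace component is forced
set_option linter.dupNamespace false

noncomputable section

namespace Summit.ResolutionOfSingularities.ResolutionOfSingularities.Theorems.FInjectiveMacaulayfication.RMonoidFreeDefs

open Summit.ResolutionOfSingularities.ResolutionOfSingularities.Theorems.FInjectiveMacaulayfication
open Summit.ResolutionOfSingularities.ResolutionOfSingularities.Theorems.WildQuotientResolution.ToricChart

/-- The word with multiplicities `m` on the seven non-dummy symbols `x₁, x₃, x₄, x₂x₃x₄, x₂x₄², x₁x₂x₄, x₁x₂x₃` (and `0` on the dummy pure symbol).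
[OURS · L1 W4.5a] -/
def wordOf (m : Fin 7 → ℕ) : Word 4 4 :=
  ⟨![m 0, 0, m 1, m 2], ![m 3, m 4, m 5, m 6]⟩

/-- Symbol multiplicities of the five basis monomials `1, x₁x₂x₃, x₂x₃x₄, x₁x₂²x₃²x₄, x₂x₄²`. [OURS · L1 W4.5a] -/
def bMult : Fin 5 → Fin 7 → ℕ :=
  ![![0, 0, 0, 0, 0, 0, 0], ![0, 0, 0, 0, 0, 0, 1], ![0, 0, 0, 1, 0, 0, 0], ![0, 0, 0, 1, 0, 0, 1], ![0, 0, 0, 0, 1, 0, 0]]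

/-- Degrees of the five basis monomials in the standard grading. [OURS · L1 W4.5a] -/
def bDeg : Fin 5 → ℕ :=
  ![0, 1, 1, 2, 1]

/-- The five unimodular cones of the half-open decomposition, as 4-tuples of symbol indices: `{x₁,x₃,x₄,x₁x₂x₄}`, `{x₁,x₃,x₁x₂x₄,x₁x₂x₃}`,
`{x₃,x₄,x₂x₃x₄,x₁x₂x₄}`, `{x₃,x₂x₃x₄,x₁x₂x₄,x₁x₂x₃}`, `{x₄,x₂x₃x₄,x₂x₄²,x₁x₂x₄}` (apexes `bMult`). [OURS · L1 W4.5a] -/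
def coneGen : Fin 5 → Fin 4 → Fin 7 :=
  ![![0, 1, 2, 5], ![0, 1, 5, 6], ![1, 2, 3, 5], ![1, 3, 5, 6], ![2, 3, 4, 5]]

/-- The lattice point `bMult i + Σ_s a_s e_{coneGen i s}` of the `i`-th half-open cone, as a multiplicity vector. [OURS · L1 W4.5a] -/
def conePoint (i : Fin 5) (a : Fin 4 → ℕ) : Fin 7 → ℕ :=
  fun j => bMult i j + ∑ s : Fin 4, if coneGen i s = j then a s else 0

variable (k : Type) [Field k]

/-- The seven non-dummy symbols of `k[R]` as ring elements. [OURS · L1 W4.5a] -/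
def symElem (j : Fin 7) : Ring k PEmpty RMonoidDefs.rDatum :=
  wordElem k PEmpty RMonoidDefs.rDatum (wordOf (Pi.single j 1))

/-- The five basis monomials as ring elements. [OURS · L1 W4.5a] -/
def bElem (i : Fin 5) : Ring k PEmpty RMonoidDefs.rDatum :=
  wordElem k PEmpty RMonoidDefs.rDatum (wordOf (bMult i))

/-- The linear homogeneous system of parameters `θ = (x₁ + x₂x₃x₄, x₃ + x₂x₄², x₄ + x₁x₂x₃, x₁x₂x₄)`. [OURS · L1 W4.5a] -/
def thetaFun : Fin 4 → Ring k PEmpty RMonoidDefs.rDatum :=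
  ![symElem k 0 + symElem k 3, symElem k 1 + symElem k 4, symElem k 2 + symElem k 6, symElem k 5]

/-- The monomial `θ^a = ∏_s θ_s ^ a_s` in the parameters. [OURS · L1 W4.5a] -/
def thetaPow (a : Fin 4 → ℕ) : Ring k PEmpty RMonoidDefs.rDatum :=
  ∏ s : Fin 4, thetaFun k s ^ a s

end Summit.ResolutionOfSingularities.ResolutionOfSingularities.Theorems.FInjectiveMacaulayfication.RMonoidFreeDefs

end
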